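import Summits.NavierStokesRegularity.NavierStokesRegularity.Theses.AxisymmetricExtremality
import Literature.Analysis.FluidPDE.MildSolutionsProofs
import Literature.Analysis.FluidPDE.AxisymmetricVorticityTransport
import Literature.Analysis.FunctionSpaces.FourierSobolevNormProofs
import Mathlib.Analysis.Distribution.Sobolev

/-!
# Crux `AxisymmetricExtremality.AxisymmetricKatoGlobal` (stmt-NavierStokesRegularity-15453) —
negative lemma: the weak divergence-freeness hypothesis is load-bearing

Refuter file (cdisprove seat, `Theorems/AxisymmetricKatoGlobal/Negative/`).  The crux reads: for
`ν > 0`, every `u₀ ∈ L³(ℝ³)` represented by some `g ∈ Ḣ^{1/2}`, weakly divergence free and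
axisymmetric (rotation-equivariance about the `x 2`-axis written out) has a global Kato solution
(`HasGlobalKatoSolution ν u₀`).

**Structural facts recorded here (all sorry-free).**

1. `isWeaklyDivFree_of_hasGlobalKatoSolution`, `memLp_three_of_hasGlobalKatoSolution`: the
   conclusion `HasGlobalKatoSolution ν u₀` OUTPUTS two of the crux's hypotheses — a global Kato
   solution `u` has weakly divergence-free slices on `[0, ∞)` (`IsMildNSSolutionOn`, first clause)
   and lies in `C([0,∞); L³)`, and `u 0 = u₀` literally.  So `IsWeaklyDivFree u₀` and
   `MemLp u₀ 3` are NECESSARY; they cost a prover nothing and cannot be weakened.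
2. `axisymmetricKatoGlobal_false_without_divFree`: the crux with the hypothesis
   `IsWeaklyDivFree u₀` deleted (`AxisymmetricKatoGlobalWithoutDivFree`) is FALSE.  Witness: the
   gradient field `u₀ = ∇b`, `b(x) = S(2 − ‖x‖²)` (`S = Real.smoothTransition`), which is smooth,
   compactly supported (hence `L³` and, through `HasCompactSupport.toSchwartzMap` +
   `SchwartzMap.memSobolev`, in `Ḣ^{1/2} ∩ L²`, represented by `HomSobolev.ofFun`), axisymmetric
   (`b` is radial, so `∇b (R_θ x) = R_θ ∇b (x)`), but not weakly divergence free: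
   `∫ ⟪∇b, ∇b⟫ > 0` against the test function `b` itself.  By item 1 it has no global Kato
   solution at any viscosity.

What this tells the provers of the line `registered` (lead c1): nothing in the crux is "free
room" except `MemLp u₀ 3` (implied by `Represents`, tree `HomSobolev.Represents.memLp_three`)
and `IsWeaklyDivFree u₀` (implied by the conclusion); the load-bearing hypotheses are `0 < ν`,
the `Ḣ^{1/2}` representation (criticality) and axisymmetry — dropping either of the last two is
the `L³`/`Ḣ^{1/2}` global-regularity problem itself, not refutable here.
-/

set_option linter.dupNamespace false

noncomputable section

open MeasureTheory Set Function Filter Topology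
open Literature.Analysis.FluidPDE Literature.Analysis.FunctionSpaces
open Literature.Analysis.FunctionSpaces.EuclideanSpace (complexify contDiff_complexify_comp_iff)
open scoped ENNReal NNReal SchwartzMap RealInnerProductSpace

namespace Summit.NavierStokesRegularity.NavierStokesRegularity.Theorems.AxisymmetricKatoGlobal.Negative

local notation "ℝ³" => EuclideanSpace ℝ (Fin 3)
local notation "ℂ³" => EuclideanSpace ℂ (Fin 3)

/-! ### Two hypotheses of the crux are necessary (output by the conclusion) -/

/-- A datum with a global Kato solution is weakly divergence free: the solution has weakly
divergence-free slices on `[0, ∞)` (first clause of `IsMildNSSolutionOn`) and `u 0 = u₀`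
(Kato 1984, Thm. 4, the class `C([0,∞); L³)` of divergence-free fields). [folklore] -/
theorem isWeaklyDivFree_of_hasGlobalKatoSolution {ν : ℝ} {u₀ : ℝ³ → ℝ³}
    (h : HasGlobalKatoSolution ν u₀) : IsWeaklyDivFree u₀ := by
  obtain ⟨u, hmild, -, h0, -⟩ := h
  subst h0
  exact hmild.1 0 (mem_Ici.2 le_rfl)

/-- A datum with a global Kato solution lies in `L³`: the solution is in `C([0,∞); L³)` and
`u 0 = u₀` (Kato 1984, Thm. 4). [folklore] -/
theorem memLp_three_of_hasGlobalKatoSolution {ν : ℝ} {u₀ : ℝ³ → ℝ³}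
    (h : HasGlobalKatoSolution ν u₀) : MemLp u₀ 3 volume := by
  obtain ⟨u, -, hcont, h0, -⟩ := h
  subst h0
  exact hcont.1 0 (mem_Ici.2 le_rfl)

/-! ### The crux without the divergence-free hypothesis -/

/-- `AxisymmetricKatoGlobal` with the hypothesis `IsWeaklyDivFree u₀` deleted (everything else
verbatim, axisymmetry written out as in the route file). -/
def AxisymmetricKatoGlobalWithoutDivFree : Prop :=
  ∀ ν : ℝ, 0 < ν → ∀ (u₀ : ℝ³ → ℝ³) (g : HomSobolev ℝ³ ℂ³ (1 / 2 : ℝ)),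
    MemLp u₀ 3 volume → g.Represents (complexify ∘ u₀) →
    (∀ (θ : ℝ) (x : ℝ³), u₀ (WithLp.toLp 2 ![Real.cos θ * x 0 - Real.sin θ * x 1,
        Real.sin θ * x 0 + Real.cos θ * x 1, x 2]) =
      WithLp.toLp 2 ![Real.cos θ * u₀ x 0 - Real.sin θ * u₀ x 1,
        Real.sin θ * u₀ x 0 + Real.cos θ * u₀ x 1, u₀ x 2]) →
    HasGlobalKatoSolution ν u₀

/-! ### The witness: the gradient of a radial bump -/

/-- The radial bump `b(x) = S(2 − ‖x‖²)`, `S` Mathlib's `Real.smoothTransition`: smooth, `= 1` on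
the unit ball, `= 0` off the ball of radius `√2`. [folklore] -/
def radBump (x : ℝ³) : ℝ := Real.smoothTransition (2 - ‖x‖ ^ 2)

/-- `b` is smooth. [folklore] -/
theorem radBump_contDiff : ContDiff ℝ (⊤ : ℕ∞) radBump :=
  Real.smoothTransition.contDiff.comp (contDiff_const.sub (contDiff_norm_sq ℝ))

/-- `b` is differentiable. [folklore] -/
theorem radBump_differentiable : Differentiable ℝ radBump :=
  radBump_contDiff.differentiable (by simp)

/-- `b = 0` where `‖x‖² ≥ 2`. [folklore] -/
theorem radBump_eq_zero {x : ℝ³} (hx : 2 ≤ ‖x‖ ^ 2) : radBump x = 0 :=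
  Real.smoothTransition.zero_of_nonpos (by linarith)

/-- `b` is supported in the closed ball of radius `2`. [folklore] -/
theorem radBump_hasCompactSupport : HasCompactSupport radBump := by
  refine HasCompactSupport.intro (isCompact_closedBall (0 : ℝ³) 2) fun x hx => ?_
  apply radBump_eq_zero
  rw [Metric.mem_closedBall, dist_zero_right, not_le] at hx
  nlinarith [norm_nonneg x]

/-- `b` is radial, in particular invariant under the rotations about the axis. [folklore] -/
theorem radBump_rotZ (θ : ℝ) (x : ℝ³) : radBump (rotZ θ x) = radBump x := by
  simp only [radBump, norm_rotZ]

/-- `b 0 = 1`. [folklore] -/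
theorem radBump_zero : radBump 0 = 1 := by
  simp only [radBump, norm_zero]
  exact Real.smoothTransition.one_of_one_le (by norm_num)

/-- `b` vanishes at the point `2 e₀`. [folklore] -/
theorem radBump_two_single : radBump (EuclideanSpace.single (0 : Fin 3) (2 : ℝ)) = 0 := by
  apply radBump_eq_zero
  norm_num [EuclideanSpace.norm_sq_eq, Fin.sum_univ_three]

/-- The witness datum: the gradient field `u₀ = ∇b`. [folklore] -/
def gradDatum (x : ℝ³) : ℝ³ := gradient radBump x

/-- `∇b = (toDual)⁻¹ ∘ Db`. [folklore] -/
theorem gradDatum_eq : gradDatum = (InnerProductSpace.toDual ℝ ℝ³).symm ∘ fderiv ℝ radBump := rfl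

/-- The witness is smooth. [folklore] -/
theorem gradDatum_contDiff : ContDiff ℝ (⊤ : ℕ∞) gradDatum := by
  rw [gradDatum_eq]
  exact (InnerProductSpace.toDual ℝ ℝ³).symm.contDiff.comp
    (radBump_contDiff.fderiv_right (by norm_cast))

/-- The witness is compactly supported. [folklore] -/
theorem gradDatum_hasCompactSupport : HasCompactSupport gradDatum := by
  rw [gradDatum_eq]
  exact (radBump_hasCompactSupport.fderiv (𝕜 := ℝ)).comp_left (map_zero _)

/-- The witness is an `L³` field. [folklore] -/
theorem gradDatum_memLp_three : MemLp gradDatum 3 (volume : Measure ℝ³) :=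
  gradDatum_contDiff.continuous.memLp_of_hasCompactSupport gradDatum_hasCompactSupport

/-- Schwartz maps lie in `Ḣ^s ∩ L²` for `s ≥ 0` (Mathlib `SchwartzMap.memSobolev` + the tree's
bridge `memSobolev_two_iff_eFourierSobolevNorm_lt_top_holds` + `H^s ⊆ Ḣ^s ∩ L²`,
`MemFourierSobolev.memHomSobolev_holds`; Bahouri–Chemin–Danchin 2011, §1.4.1).  Private copy of
the argument of `thresholdFinite_memHomSobolev_schwartz`
(`Theorems/AxisymmetricExtremalityMinimalDatumPFoldThresholdFinite.lean`, itself private). [folklore] -/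
private theorem memHomSobolev_schwartz {E F : Type*} [NormedAddCommGroup E]
    [InnerProductSpace ℝ E] [FiniteDimensional ℝ E] [MeasurableSpace E] [BorelSpace E]
    [NormedAddCommGroup F] [InnerProductSpace ℂ F] [CompleteSpace F] {s : ℝ} (hs : 0 ≤ s)
    (f : 𝓢(E, F)) : MemHomSobolev s (⇑f) := by
  have hB : TemperedDistribution.MemSobolev s 2
      ((f.toLp 2 (volume : Measure E) : Lp F 2 (volume : Measure E)) : 𝓢'(E, F)) := by
    rw [Lp.toTemperedDistribution_toLp_eq]
    exact f.memSobolev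
  have h := memSobolev_two_iff_eFourierSobolevNorm_lt_top_holds (E := E) (F := F)
  exact MemFourierSobolev.memHomSobolev_holds hs ⟨f.memLp 2 volume, (h s _).1 hB⟩

/-- The complexified witness lies in `Ḣ^{1/2} ∩ L²` (it is a compactly supported smooth map,
hence Schwartz). [folklore] -/
theorem gradDatum_memHomSobolev : MemHomSobolev (1 / 2 : ℝ) (complexify ∘ gradDatum) := by
  have hs : ContDiff ℝ (⊤ : ℕ∞) (complexify ∘ gradDatum) := contDiff_complexify_comp_iff.2 gradDatum_contDiff
  have hc : HasCompactSupport (complexify ∘ gradDatum) :=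
    gradDatum_hasCompactSupport.comp_left (map_zero _)
  exact memHomSobolev_schwartz (by norm_num) (hc.toSchwartzMap hs)

/-- The complexified witness is represented by its own class `ofFun _ ∈ Ḣ^{1/2}`
(`HomSobolev.represents_ofFun_holds`). [folklore] -/
theorem gradDatum_represents :
    (HomSobolev.ofFun (complexify ∘ gradDatum) gradDatum_memHomSobolev).Represents (complexify ∘ gradDatum) :=
  HomSobolev.represents_ofFun_holds (by rw [finrank_euclideanSpace_fin]; norm_num) _ _

/-- Chain rule for the radial bump: `Db(R_θ x)[R_θ v] = Db(x)[v]`. [folklore] -/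
theorem fderiv_radBump_rotZ (θ : ℝ) (x v : ℝ³) :
    fderiv ℝ radBump (rotZ θ x) (rotZ θ v) = fderiv ℝ radBump x v := by
  have hcomp : (fun y => radBump (rotZL θ y)) = radBump := funext fun y => radBump_rotZ θ y
  have hl : HasFDerivAt (fun y => radBump (rotZL θ y)) ((fderiv ℝ radBump (rotZ θ x)).comp (rotZL θ)) x :=
    (radBump_differentiable (rotZL θ x)).hasFDerivAt.comp x (rotZL θ).hasFDerivAt
  rw [hcomp] at hl
  rw [hl.fderiv, ContinuousLinearMap.comp_apply, rotZL_apply]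

/-- **The witness is axisymmetric**: `∇b (R_θ x) = R_θ (∇b x)` (a radial scalar has a
rotation-equivariant gradient). [folklore] -/
theorem gradDatum_rotZ (θ : ℝ) (x : ℝ³) : gradDatum (rotZ θ x) = rotZ θ (gradDatum x) := by
  have hw : ∀ w : ℝ³, rotZ θ (rotZ (-θ) w) = w := fun w => by
    rw [← rotZ_add, add_neg_cancel, rotZ_zero]
  refine ext_inner_right ℝ fun w => ?_
  conv_rhs => rw [← hw w, gradDatum, ← rotZLIE_apply θ (gradient radBump x),
    ← rotZLIE_apply θ (rotZ (-θ) w), LinearIsometryEquiv.inner_map_map]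
  conv_lhs => rw [← hw w, gradDatum]
  simp only [gradient, InnerProductSpace.toDual_symm_apply, fderiv_radBump_rotZ]

/-- The written-out form of axisymmetry used by the route file. [folklore] -/
theorem gradDatum_rotZ' (θ : ℝ) (x : ℝ³) :
    gradDatum (WithLp.toLp 2 ![Real.cos θ * x 0 - Real.sin θ * x 1,
        Real.sin θ * x 0 + Real.cos θ * x 1, x 2]) =
      WithLp.toLp 2 ![Real.cos θ * gradDatum x 0 - Real.sin θ * gradDatum x 1,
        Real.sin θ * gradDatum x 0 + Real.cos θ * gradDatum x 1, gradDatum x 2] :=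
  gradDatum_rotZ θ x

/-- **The witness is not weakly divergence free**: tested against `b` itself,
`∫ ⟪∇b, ∇b⟫ = ∫ ‖∇b‖² > 0`, since `∇b` is continuous and not identically zero (`b(0) = 1`,
`b(2e₀) = 0`). [folklore] -/
theorem gradDatum_not_isWeaklyDivFree : ¬ IsWeaklyDivFree gradDatum := by
  intro h
  have htest : IsTestFunctionOn (⊤ : TopologicalSpace.Opens ℝ³) radBump :=
    ⟨radBump_contDiff, radBump_hasCompactSupport, fun _ _ => trivial⟩
  have h0 : ∫ x, ⟪gradDatum x, gradient radBump x⟫ = 0 := h radBump htest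
  have hcont : Continuous fun x => ⟪gradDatum x, gradient radBump x⟫ :=
    gradDatum_contDiff.continuous.inner gradDatum_contDiff.continuous
  have hcs : HasCompactSupport fun x => ⟪gradDatum x, gradient radBump x⟫ :=
    gradDatum_hasCompactSupport.mono fun x hx => by
      rw [Function.mem_support] at hx ⊢
      contrapose! hx
      rw [hx, inner_zero_left]
  have hint : Integrable (fun x => ⟪gradDatum x, gradient radBump x⟫) volume :=
    hcont.integrable_of_hasCompactSupport hcs
  have hnn : 0 ≤ fun x => ⟪gradDatum x, gradient radBump x⟫ := fun x => real_inner_self_nonneg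
  have hne : (Function.support fun x => ⟪gradDatum x, gradient radBump x⟫).Nonempty := by
    by_contra hemp
    rw [Set.not_nonempty_iff_eq_empty, Function.support_eq_empty_iff] at hemp
    have hzero : ∀ y, fderiv ℝ radBump y = 0 := fun y => by
      have hy := congr_fun hemp y
      simp only [Pi.zero_apply, gradDatum, inner_self_eq_zero] at hy
      rw [← toDual_gradient, hy, map_zero]
    have hc := is_const_of_fderiv_eq_zero radBump_differentiable hzero 0
      (EuclideanSpace.single (0 : Fin 3) (2 : ℝ))
    rw [radBump_zero, radBump_two_single] at hc
    exact one_ne_zero hc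
  have hpos : 0 < ∫ x, ⟪gradDatum x, gradient radBump x⟫ :=
    (integral_pos_iff_support_of_nonneg hnn hint).2 (hcont.isOpen_support.measure_pos volume hne)
  exact hpos.ne' h0

/-! ### The negative lemma -/

/-- **Any proof of the crux must use `IsWeaklyDivFree u₀`.**  The crux with that hypothesis
deleted is false: the gradient datum `∇b` (smooth, compactly supported, hence `L³` and
`Ḣ^{1/2}`-represented; axisymmetric) would have a global Kato solution at `ν = 1`, whose slice at
`t = 0` is `∇b` itself and is weakly divergence free — but `∇b` is not. [folklore] -/
theorem axisymmetricKatoGlobal_false_without_divFree : ¬ AxisymmetricKatoGlobalWithoutDivFree := by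
  intro h
  have hK : HasGlobalKatoSolution 1 gradDatum :=
    h 1 one_pos gradDatum _ gradDatum_memLp_three gradDatum_represents gradDatum_rotZ'
  exact gradDatum_not_isWeaklyDivFree (isWeaklyDivFree_of_hasGlobalKatoSolution hK)

/-- Sanity link with the route decl: the crux is exactly `AxisymmetricKatoGlobalWithoutDivFree`
with the hypothesis `IsWeaklyDivFree u₀` re-inserted, so the crux trivially implies nothing
refuted here — recorded as the implication in the harmless direction (the crux gives the
`WithoutDivFree` statement restricted to weakly divergence-free data). [folklore] -/
theorem withoutDivFree_of_axisymmetricKatoGlobal_restricted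
    (h : Theses.AxisymmetricExtremality.AxisymmetricKatoGlobal) :
    ∀ ν : ℝ, 0 < ν → ∀ (u₀ : ℝ³ → ℝ³) (g : HomSobolev ℝ³ ℂ³ (1 / 2 : ℝ)),
      MemLp u₀ 3 volume → g.Represents (complexify ∘ u₀) → IsWeaklyDivFree u₀ →
      IsAxisymmetric u₀ → HasGlobalKatoSolution ν u₀ :=
  fun ν hν u₀ g h3 hrep hdiv hax => h ν hν u₀ g h3 hrep hdiv hax

end Summit.NavierStokesRegularity.NavierStokesRegularity.Theorems.AxisymmetricKatoGlobal.Negative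

end
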